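import Mathlib.Analysis.InnerProductSpace.Orientation
import Mathlib.Analysis.InnerProductSpace.TwoDim
import Mathlib.Analysis.InnerProductSpace.PiL2
import Mathlib.Analysis.Normed.Module.Alternating.Basic
import Mathlib.Topology.Algebra.Module.Alternating.Topology
import Mathlib.Order.Hom.PowersetCard
import Mathlib.LinearAlgebra.BilinearForm.Properties
import Literature.Geometry.Kaehler.AlternatingAux
import HarnessLib

-- provenance: harness21/H21/H21/Prelude/Kaehler/HodgeStar.lean @ c2961f6 (interim HEAD d8f2665); M5 mechanical rewrite
/-!
# The pointwise Hodge star (trunk: Kähler / Hodge, item K2; notion `riemannian_metric`)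

Linear algebra of the Hodge star operator on a finite-dimensional oriented real inner product
space `V` with `finrank ℝ V = n` and an orientation `o : Orientation ℝ V (Fin n)` (the setting of
Mathlib's `Orientation.volumeForm`). Forms of degree `k` are *continuous* alternating maps
`V [⋀^Fin k]→L[ℝ] ℝ` (the type used by Mathlib's `extDeriv` and by the manifold layer
`H21/Prelude/Kaehler/RiemannianHodge.lean`).

Contents:

* `Orientation.volumeFormL o`: Mathlib's `o.volumeForm` as a *continuous* alternating map.
* `stdOrthonormalBasisFin V n`: an orthonormal basis indexed by `Fin n`;
  `OrthonormalBasis.multiIndex b s`: the `k`-tuple `(b s₀, …, b s_{k-1})` attached to an increasing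
  multi-index `s : Set.powersetCard (Fin n) k`.
* `alternatingFormInner V n k`: the induced inner product on `k`-forms,
  `⟪α, β⟫ = ∑_{|s| = k} α(b_s) β(b_s)`, as a `LinearMap.BilinForm` (no `InnerProductSpace`
  instance: the type of continuous alternating maps already carries the operator norm, which is
  not this Euclidean norm).
* `hodgeStar o h`: for `h : k + m = n`, the Hodge star `⋆ : Λᵏ V* → Λᵐ V*`,
  `(⋆β)(w) = ∑_{|s| = k} β(b_s) · vol(b_s, w)`, i.e. `⋆e^I = ε(I, Iᶜ) e^{Iᶜ}`; a linear map.
* API: basis independence (`alternatingFormInner_eq_sum`, `hodgeStar_apply_eq_sum`), symmetry and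
  positivity of the inner product, `⋆⋆ = (-1)^{km}`, `⋆` is an isometry, `⋆_{-o} = -⋆_o`,
  `⋆1 = vol`, `⋆vol = 1`, the contraction characterisation
  `hodgeStar_apply_eq_alternatingFormInner` (which replaces `α ∧ ⋆β = ⟪α, β⟫ vol`, as Mathlib has
  no wedge product of alternating maps), injectivity, and the two-dimensional sanity check against
  `Orientation.areaForm`.

Mathlib search: Mathlib has `Orientation.volumeForm`, `Orientation.areaForm`,
`Orientation.rightAngleRotation` (the `n = 2`, `k = 1` Hodge star on vectors), `stdOrthonormalBasis`,
`OrthonormalBasis.reindex`, `Set.powersetCard.ofFinEmbEquiv`, `ContinuousAlternatingMap.apply`,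
but no Hodge star and no inner product on alternating maps (searched `hodgeStar`, `HodgeStar`: no
hits); these are defined here.

## Design notes

* Degrees are governed by an explicit equation `h : k + m = n`, never by `n - k`.
* As in Mathlib's `Orientation.volumeForm`, `[FiniteDimensional ℝ V]` is assumed only where it is
  used (everything built on `stdOrthonormalBasis`); `volumeFormL` and `multiIndex` do not need it.
* `V` and `n` are explicit arguments of `stdOrthonormalBasisFin` and `alternatingFormInner`
  (nothing else determines them; with `n` implicit, uses on tangent spaces get stuck on
  `Fact (finrank ℝ (TangentSpace I x) = ?n)`); in `hodgeStar o h` they are implicit (`o` fixes both).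
* No proofs inside definitions: linearity of `hodgeStar` and bilinearity of `alternatingFormInner`
  come for free from `LinearMap.smulRight` and finite sums.
* The definitions use the fixed basis `stdOrthonormalBasisFin V n`; independence of the orthonormal
  basis is a theorem (`alternatingFormInner_eq_sum`, `hodgeStar_apply_eq_sum`). The orientation
  enters only through `volumeFormL`, so no case split on `0 < n` is needed.
* `Orientation.volumeFormL`, `Orientation.volumeFormL_apply`, `Orientation.volumeFormL_neg` and
  `OrthonormalBasis.multiIndex` are *deliberate* dot-notation extensions of the Mathlib namespaces
  `Orientation` and `OrthonormalBasis`, written `_root_.…` inside `namespace Literature`. Everything else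
  lives in `Literature`.
* No continuous-linear bundling `hodgeStarL` (Mathlib has no `FiniteDimensional` instance on the
  space of continuous alternating maps; nothing downstream needs it).

## References

* F. W. Warner, *Foundations of Differentiable Manifolds and Lie Groups* (1983), §2.6, Ex. 2.13,
  §6.1.
* J. Jost, *Riemannian Geometry and Geometric Analysis*, §3.3.
-/

noncomputable section

open Module ContinuousAlternatingMap

namespace Literature.Geometry.Kaehler

variable {V : Type*} [NormedAddCommGroup V] [InnerProductSpace ℝ V]

section VolumeForm

variable {n : ℕ} [Fact (finrank ℝ V = n)] (o : Orientation ℝ V (Fin n))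

/-- The Riemannian volume form of an oriented finite-dimensional real inner product space, as a
*continuous* alternating map: Mathlib's `Orientation.volumeForm` (an `AlternatingMap`) made
continuous via the bound `|vol(v)| ≤ ∏ ‖v i‖` (`Orientation.abs_volumeForm_apply_le`).
See Warner, *Foundations*, §6.1 (before 6.2). Deliberate extension of the Mathlib namespace
`Orientation`. [folklore] -/
def _root_.Orientation.volumeFormL : V [⋀^Fin n]→L[ℝ] ℝ :=
  o.volumeForm.mkContinuous 1 (fun v ↦ by simpa using o.abs_volumeForm_apply_le v)

/-- `o.volumeFormL` evaluates as `o.volumeForm` (by construction). [folklore] -/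
@[simp]
theorem _root_.Orientation.volumeFormL_apply (v : Fin n → V) :
    o.volumeFormL v = o.volumeForm v :=
  rfl

/-- The underlying alternating map of `o.volumeFormL` is `o.volumeForm`. [folklore] -/
@[simp]
theorem _root_.Orientation.toAlternatingMap_volumeFormL :
    o.volumeFormL.toAlternatingMap = o.volumeForm :=
  rfl

/-- Reversing the orientation negates the volume form
(Mathlib `Orientation.volumeForm_neg_orientation`; Warner, *Foundations*, §6.1). [folklore] -/
@[simp]
theorem _root_.Orientation.volumeFormL_neg : (-o).volumeFormL = -o.volumeFormL := by
  ext v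
  simp [Orientation.volumeForm_neg_orientation]

end VolumeForm

section Basis

variable {n : ℕ}

variable (V n) in
/-- A fixed orthonormal basis of `V` indexed by `Fin n` (where `finrank ℝ V = n`): Mathlib's
`stdOrthonormalBasis ℝ V`, reindexed along `finCongr`. `V` and `n` are explicit.
(Standard; cf. Warner, *Foundations*, Ex. 2.13.) [folklore] -/
def stdOrthonormalBasisFin [FiniteDimensional ℝ V] [Fact (finrank ℝ V = n)] :
    OrthonormalBasis (Fin n) ℝ V :=
  (stdOrthonormalBasis ℝ V).reindex (finCongr Fact.out)

/-- The `k`-tuple of basis vectors `(b s₀, …, b s_{k-1})` attached to an increasing multi-index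
`s = {s₀ < ⋯ < s_{k-1}} ⊆ Fin n` (via `Set.powersetCard.ofFinEmbEquiv`). These tuples, for
`s : Set.powersetCard (Fin n) k`, are dual to the standard basis `e^s` of `k`-forms
(Warner, *Foundations*, 2.6, Ex. 2.13). Deliberate extension of the Mathlib namespace
`OrthonormalBasis`. [folklore] -/
def _root_.OrthonormalBasis.multiIndex (b : OrthonormalBasis (Fin n) ℝ V) {k : ℕ}
    (s : Set.powersetCard (Fin n) k) : Fin k → V :=
  fun i ↦ b (Set.powersetCard.ofFinEmbEquiv.symm s i)

/-- Unfolding of `OrthonormalBasis.multiIndex`. [folklore] -/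
@[simp]
theorem _root_.OrthonormalBasis.multiIndex_apply (b : OrthonormalBasis (Fin n) ℝ V) {k : ℕ}
    (s : Set.powersetCard (Fin n) k) (i : Fin k) :
    b.multiIndex s i = b (Set.powersetCard.ofFinEmbEquiv.symm s i) :=
  rfl

end Basis

section Inner

variable [FiniteDimensional ℝ V] (V) (n : ℕ) [Fact (finrank ℝ V = n)]

/-- The inner product induced on continuous alternating `k`-forms by the inner product of `V`:
`⟪α, β⟫ = ∑_{|s| = k} α(b_s) β(b_s)`, the sum running over increasing multi-indices
`s : Set.powersetCard (Fin n) k` and `b = stdOrthonormalBasisFin V n`; equivalently the unique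
inner product for which `{e^s}` is orthonormal (Warner, *Foundations*, Ex. 2.13; Jost,
*Riemannian Geometry*, §3.3). It is independent of the orthonormal basis
(`alternatingFormInner_eq_sum`). Bundled as a bilinear form, *not* as an `InnerProductSpace`
instance (the type already carries the operator norm). `V` and `n` are explicit. [folklore] -/
def alternatingFormInner (k : ℕ) : LinearMap.BilinForm ℝ (V [⋀^Fin k]→L[ℝ] ℝ) :=
  ∑ s : Set.powersetCard (Fin n) k,
    (ContinuousAlternatingMap.apply ℝ V ℝ
      ((stdOrthonormalBasisFin V n).multiIndex s)).toLinearMap.smulRight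
      (ContinuousAlternatingMap.apply ℝ V ℝ ((stdOrthonormalBasisFin V n).multiIndex s)).toLinearMap

variable {V n}

/-- Unfolding of `alternatingFormInner`: `⟪α, β⟫ = ∑_s α(b_s) β(b_s)` with
`b = stdOrthonormalBasisFin V n`. [folklore] -/
@[simp]
theorem alternatingFormInner_apply (k : ℕ) (α β : V [⋀^Fin k]→L[ℝ] ℝ) :
    alternatingFormInner V n k α β = ∑ s : Set.powersetCard (Fin n) k,
      α ((stdOrthonormalBasisFin V n).multiIndex s) *
        β ((stdOrthonormalBasisFin V n).multiIndex s) := by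
  simp [alternatingFormInner, LinearMap.sum_apply]

/-- Basis independence: for *any* orthonormal basis `b` of `V` indexed by `Fin n`,
`⟪α, β⟫ = ∑_s α(b_s) β(b_s)` (Warner, *Foundations*, Ex. 2.13). [cite: WarnerGTM94, Ex. 2.13] -/
def alternatingFormInner_eq_sum : Prop :=
  ∀ (b : OrthonormalBasis (Fin n) ℝ V) (k : ℕ) (α β : V [⋀^Fin k]→L[ℝ] ℝ),
    alternatingFormInner V n k α β =
      ∑ s : Set.powersetCard (Fin n) k, α (b.multiIndex s) * β (b.multiIndex s)

/-- The induced inner product on `k`-forms is symmetric (Warner, *Foundations*, Ex. 2.13). [folklore] -/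
theorem isSymm_alternatingFormInner (k : ℕ) : (alternatingFormInner V n k).IsSymm :=
  LinearMap.BilinForm.isSymm_def.2 fun α β ↦ by
    simp only [alternatingFormInner_apply, mul_comm (α _)]

/-- The induced inner product on `k`-forms is positive semidefinite: `0 ≤ ⟪α, α⟫`
(Warner, *Foundations*, Ex. 2.13). [folklore] -/
theorem alternatingFormInner_self_nonneg (k : ℕ) (α : V [⋀^Fin k]→L[ℝ] ℝ) :
    0 ≤ alternatingFormInner V n k α α := by
  rw [alternatingFormInner_apply]
  exact Finset.sum_nonneg fun s _ ↦ mul_self_nonneg _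

/-- The induced inner product on `k`-forms is definite: `⟪α, α⟫ = 0 ↔ α = 0`
(Warner, *Foundations*, Ex. 2.13). [cite: WarnerGTM94, Ex. 2.13] -/
def alternatingFormInner_self_eq_zero_iff : Prop :=
  ∀ (k : ℕ) (α : V [⋀^Fin k]→L[ℝ] ℝ),
    alternatingFormInner V n k α α = 0 ↔ α = 0

/-- The volume form has unit length: `⟪vol, vol⟫ = 1` (Warner, *Foundations*, Ex. 2.13 (c)). [cite: WarnerGTM94, Ex. 2.13 (c)] -/
def alternatingFormInner_volumeFormL_volumeFormL : Prop :=
  ∀ (o : Orientation ℝ V (Fin n)),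
    alternatingFormInner V n n o.volumeFormL o.volumeFormL = 1

end Inner

section HodgeStar

variable [FiniteDimensional ℝ V] {n : ℕ} [Fact (finrank ℝ V = n)] (o : Orientation ℝ V (Fin n))
  {k m : ℕ}

/-- The (pointwise) **Hodge star operator** `⋆ : Λᵏ V* → Λᵐ V*` of an oriented finite-dimensional
real inner product space, for degrees related by `h : k + m = n`:
`(⋆β)(w) = ∑_{|s| = k} β(b_s) · vol(b_s, w)`, the sum over increasing multi-indices `s` and
`b = stdOrthonormalBasisFin V n`; on the standard basis of forms `⋆e^I = ε(I, Iᶜ) e^{Iᶜ}`. It is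
characterised by `α ∧ ⋆β = ⟪α, β⟫ vol` (Warner, *Foundations of Differentiable Manifolds and Lie
Groups*, Ex. 2.13, §6.1; Jost, *Riemannian Geometry*, §3.3); see
`hodgeStar_apply_eq_alternatingFormInner` for the contraction form of this characterisation.
Linear by construction (a finite sum of `LinearMap.smulRight`s); independent of the orthonormal
basis (`hodgeStar_apply_eq_sum`). [folklore] -/
def hodgeStar (h : k + m = n) : (V [⋀^Fin k]→L[ℝ] ℝ) →ₗ[ℝ] (V [⋀^Fin m]→L[ℝ] ℝ) :=
  ∑ s : Set.powersetCard (Fin n) k,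
    (ContinuousAlternatingMap.apply ℝ V ℝ
      ((stdOrthonormalBasisFin V n).multiIndex s)).toLinearMap.smulRight
      ((o.volumeFormL.domDomCongr (finCongr (show n = m + k by omega))).interiorProductMulti k
        ((stdOrthonormalBasisFin V n).multiIndex s))

/-- Unfolding of `hodgeStar`: `(⋆β)(w) = ∑_s β(b_s) vol(b_s, w)` with
`b = stdOrthonormalBasisFin V n` (Warner, *Foundations*, Ex. 2.13). [folklore] -/
@[simp]
theorem hodgeStar_apply (h : k + m = n) (β : V [⋀^Fin k]→L[ℝ] ℝ) (w : Fin m → V) :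
    hodgeStar o h β w = ∑ s : Set.powersetCard (Fin n) k,
      β ((stdOrthonormalBasisFin V n).multiIndex s) *
        (o.volumeFormL.domDomCongr (finCongr (show n = m + k by omega))).interiorProductMulti k
          ((stdOrthonormalBasisFin V n).multiIndex s) w := by
  simp [hodgeStar, LinearMap.sum_apply]

/-- Basis independence of the Hodge star: for *any* orthonormal basis `b` of `V` indexed by
`Fin n`, `(⋆β)(w) = ∑_s β(b_s) vol(b_s, w)` (Warner, *Foundations*, Ex. 2.13). [cite: WarnerGTM94, Ex. 2.13] -/
def hodgeStar_apply_eq_sum : Prop :=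
  ∀ (b : OrthonormalBasis (Fin n) ℝ V) (h : k + m = n) (β : V [⋀^Fin k]→L[ℝ] ℝ) (w : Fin m → V),
    hodgeStar o h β w = ∑ s : Set.powersetCard (Fin n) k,
      β (b.multiIndex s) *
        (o.volumeFormL.domDomCongr (finCongr (show n = m + k by omega))).interiorProductMulti k
          (b.multiIndex s) w

/-- `⋆⋆ = (-1)^{k(n-k)}` on `k`-forms (Warner, *Foundations*, Ex. 2.13 (d), §6.1 (6.1.1)). [cite: WarnerGTM94, Ex. 2.13 (d) and (6.1.1)] -/
def hodgeStar_hodgeStar : Prop :=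
  ∀ (h : k + m = n) (h' : m + k = n) (β : V [⋀^Fin k]→L[ℝ] ℝ),
    hodgeStar o h' (hodgeStar o h β) = ((-1 : ℝ) ^ (k * m)) • β

/-- The Hodge star is an isometry for the induced inner products: `⟪⋆α, ⋆β⟫ = ⟪α, β⟫`
(Warner, *Foundations*, Ex. 2.13 (e)). [cite: WarnerGTM94, Ex. 2.13 (e)] -/
def alternatingFormInner_hodgeStar_hodgeStar : Prop :=
  ∀ (h : k + m = n) (α β : V [⋀^Fin k]→L[ℝ] ℝ),
    alternatingFormInner V n m (hodgeStar o h α) (hodgeStar o h β) =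
      alternatingFormInner V n k α β

/-- Reversing the orientation negates the Hodge star: `⋆_{-o} = -⋆_o`
(Warner, *Foundations*, Ex. 2.13). [folklore] -/
theorem hodgeStar_neg_orientation (h : k + m = n) : hodgeStar (-o) h = -hodgeStar o h := by
  ext β w
  rw [LinearMap.neg_apply, ContinuousAlternatingMap.neg_apply, hodgeStar_apply, hodgeStar_apply,
    Orientation.volumeFormL_neg, ← neg_one_smul ℝ o.volumeFormL, domDomCongr_smul,
    ← Finset.sum_neg_distrib]
  refine Finset.sum_congr rfl fun s _ ↦ ?_
  rw [interiorProductMulti_smul, ContinuousAlternatingMap.smul_apply, smul_eq_mul]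
  ring

/-- `⋆1 = vol`: the Hodge star of the constant `0`-form `1` is the volume form
(Warner, *Foundations*, Ex. 2.13 (c)). [cite: WarnerGTM94, Ex. 2.13 (c)] -/
def hodgeStar_constOfIsEmpty_one : Prop :=
  ∀ (h : 0 + n = n),
    hodgeStar o h (constOfIsEmpty ℝ V (Fin 0) 1) = o.volumeFormL

/-- `⋆vol = 1`: the Hodge star of the volume form is the constant `0`-form `1`
(Warner, *Foundations*, Ex. 2.13 (c)). [cite: WarnerGTM94, Ex. 2.13 (c)] -/
def hodgeStar_volumeFormL : Prop :=
  ∀ (h : n + 0 = n),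
    hodgeStar o h o.volumeFormL = constOfIsEmpty ℝ V (Fin 0) 1

/-- Contraction characterisation of the Hodge star, the substitute for `α ∧ ⋆β = ⟪α, β⟫ vol`
(Mathlib has no wedge product of alternating maps): for `w : Fin m → V`,
`(⋆β)(w) = (-1)^{km} ⟪β, ι_w vol⟫`, where `ι_w vol` is the `k`-form `v ↦ vol(w, v)`
(Warner, *Foundations*, Ex. 2.13, §6.1; Jost, *Riemannian Geometry*, §3.3). [cite: WarnerGTM94, Ex. 2.13 and §6.1] -/
def hodgeStar_apply_eq_alternatingFormInner : Prop :=
  ∀ (h : k + m = n) (β : V [⋀^Fin k]→L[ℝ] ℝ) (w : Fin m → V),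
    hodgeStar o h β w = (-1 : ℝ) ^ (k * m) * alternatingFormInner V n k β
      ((o.volumeFormL.domDomCongr (finCongr (show n = k + m by omega))).interiorProductMulti m w)

/-- The Hodge star is injective (indeed bijective, by `hodgeStar_hodgeStar`)
(Warner, *Foundations*, Ex. 2.13 (d)). [folklore] -/
def hodgeStar_injective : Prop :=
  ∀ (h : k + m = n),
    Function.Injective (hodgeStar o h)

/- interim proof relied on results that are now named facts (D-0014); demoted to a fact by the M5 import, proof preserved:
:= by
  intro α β hαβ
  have := congrArg (hodgeStar o (show m + k = n by omega)) hαβ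
  have hc : ((-1 : ℝ) ^ (k * m)) ≠ 0 := pow_ne_zero _ (neg_ne_zero.2 one_ne_zero)
  simpa [hodgeStar_hodgeStar o h, smul_right_inj hc] using this
-/

end HodgeStar

section TwoDim

variable [FiniteDimensional ℝ V] [Fact (finrank ℝ V = 2)] (o : Orientation ℝ V (Fin 2))

/-- Two-dimensional sanity check: for `n = 2`, `k = m = 1`, the Hodge star of the `1`-form
`⟪v, ·⟫` is the `1`-form `o.areaForm v = ⟪J v, ·⟫`, i.e. `⋆` on `1`-forms is dual to Mathlib's
`Orientation.rightAngleRotation` (`⋆dx = dy`, `⋆dy = -dx`; Warner, *Foundations*, Ex. 2.13;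
Mathlib `Orientation.areaForm`). [cite: WarnerGTM94, Ex. 2.13] -/
def hodgeStar_apply_eq_areaForm : Prop :=
  ∀ (h : 1 + 1 = 2) (v w : V),
    hodgeStar o h (ofSubsingleton ℝ V ℝ (0 : Fin 1) (innerSL ℝ v)) ![w] = o.areaForm v w

end TwoDim

end Literature.Geometry.Kaehler
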